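import Summits.Parity.GeneralizedHardyLittlewood.Theorems.PrimeLevelFamEdgeIdeaDeltasWucLadderRails
import Literature.NumberTheory.LFunctions.SiegelZeroFormSumAsymptoticProofs
import Literature.NumberTheory.LFunctions.SiegelTheorem
import Literature.NumberTheory.QuadraticFields.ClassGroupExponentTwoCriteria
import Literature.NumberTheory.QuadraticFields.ClassNumberOneGenus
import Literature.NumberTheory.QuadraticFields.AmbiguousReducedFormsCount
import Literature.NumberTheory.QuadraticFields.ClassNumbersUpToOneHundred
import HarnessLib

/-!
# Route `PrimeLevelFamEdge` — TYPED IDEA DELTAS, deck 11‴ (LANDING NOTE typer ls-idea-typ-1 gen 4: lens-13 g14's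
# `HOME/ls-idea-lens-13/g14/Sketch_WucGenusFloor_v2.lean` sha16 1f7e1352a47e464d VERBATIM up to namespace `Summit.Parity.GeneralizedHardyLittlewood.Sketch.Wuc13W2CD`
# → `…Theorems.PrimeLevelFamEdgeIdeaDeltas.WucGenusFloor`; K-L13-5 «GENUS RAIL», L(1)-currency half (gen-2 Parts C/D; marks of record
# A b112 · B b114 · C b96 · D b30 PASS); optional close-out typing offer l.3123; companion of decks 11/11′/11″.)
#
# Sketch — `wuc` wave 2, Parts C + D, LANDING-READY v2 (ls-idea-lens-13, gen 14, 2026-08-28): the GENUS RAIL in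
# `L(1)`-currency (Dirichlet's class number formula; the BC2-converse of card K-L13-5, kernel-side) and the
# Watkins residue (K-L13-6 row (4))

v2 = `Sketch_WucWave2_PartC.lean` (7c72b31cc51fb93e, gen 2; marks A b112 · B b114 · C b96 · D b30 PASS) with its
verbatim copies of the Part B objects REMOVED — `OneClassPerGenus`, `oneClassPerGenus_iff_classNumber_eq`,
`NoOneClassPerGenusBeyond` are now the TREE declarations of deck 11″
`Summits/Parity/GeneralizedHardyLittlewood/Theorems/PrimeLevelFamEdgeIdeaDeltasWucLadderRails.lean`
(namespace `…Theorems.PrimeLevelFamEdgeIdeaDeltas.Wuc`, p607133), imported and opened below — followed by the two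
Watkins theorems of `Sketch_WucWave2_PartD_Watkins.lean` (e72b93faa5bee544, gen 2; marks A b114.2 · C b97 PASS),
whose auxiliary lemmas are Part C's. Statements and proofs otherwise BYTE-IDENTICAL to the gen-2 files.
SKETCH ONLY (pub folder, not a proposal); everything here is PROVED over tree theorems (Part D modulo the tree's
NAMED FACT `watkins2004_table4`, used as a hypothesis exactly as the tree does); nothing open is decided.

For an odd primitive quadratic character `χ` mod `D > 4` (⟺ `−D` is a fundamental discriminant `< −4`,
tree `PrimitiveQuadratic.isFundamentalDiscriminant_neg`), the tree's PROVED class number formula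
(`GoldfeldSchinzel1975.LFunction_one_re_eq`: `Re L(1,χ) = π h_K/√D`, with Cox Thm 7.7(ii)
`Quadratic.card_reducedForms_eq_classNumber` and the bridge of the two form class numbers
`BinaryQuadraticForm.binQF_classNumber_eq`) reads `h(−D) = √D·‖L(1,χ)‖/π` (`binQF_classNumber_neg_eq`), and Cox's
`μ(−D)` is `ω(D)` (`assignedCharCount_eq_card_primeFactors_of_isFundamental`). Consequences, all PROVED here:

* `genusFloor_le_norm_LFunction_one` — the **GENUS FLOOR** `π·2^{ω(D)−1}/√D ≤ ‖L(1,χ)‖` (Gauss/Cox Prop 3.11: the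
  ambiguous reduced forms number `2^{μ−1}`, so `h(−D) ≥ 2^{μ−1}`): the PROVED bottom rung of the explicit rail at odd
  characters — the only pointwise explicit minorant that GROWS with `ω(D)` (GGZ's `(log D)∏_p(1−⌊2√p⌋/(p+1))/√D`
  is incomparable with it: better for `ω(D)` small, worse for `ω(D) ≳ log₂ log D`);
* `oneClassPerGenus_iff_norm_eq_genusFloor` — ONE CLASS PER GENUS at `−D` ⟺ EQUALITY in the genus floor;
* `NoOneClassPerGenusBeyondFund N` (Euler's idoneal problem restricted to fundamental discriminants, stated per odd
  primitive quadratic `χ`; implied by deck 11″'s rung `NoOneClassPerGenusBeyond N`, `noOneClassPerGenusBeyondFund_of_beyond`)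
  ⟺ the **STRICT genus floor beyond `N`** (`noOneClassPerGenusBeyondFund_iff_genusFloorStrict`): Euler's problem IS
  the strictness of the proved floor — the weakest named open rung of the explicit rail, in the leaf's own currency;
* BC2-converse (K-L13-5), kernel form: `noOneClassPerGenusBeyondFund_of_explicit` — the EXPLICIT leaf
  `LOneLowerBoundExplicit c₁ A` (deck 11) plus the numeric crossover `π·2^{ω(D)−1}/√D < c₁/(log D)^A for D > N` (this
  hypothesis is the DEFINITION of the card's `N×(c₁,A)`; it holds for large `N` since `2^{ω(D)} = D^{O(1/log log D)}`)
  gives the rung beyond `N`; `exists_noOneClassPerGenusBeyondFund_of_lOneLowerBound` — the ∃-leaf `LOneLowerBound A`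
  gives only `∃ N` (Chowla's 1934 theorem shape — known unconditionally, so the ∃-leaf earns nothing here: J1′ pattern),
  the growth fact being supplied as a hypothesis (elementary, not chased in Mathlib);
* `eight_le_card_primeFactors_of_oneClassPerGenus` — modulo `watkins2004_table4` (Watkins 2004, complete lists of
  imaginary quadratic fields with `h_K ≤ 100`; tree `Watkins2004.hundred_lt_classNumber`: `h_K > 100` once
  `D > 2 383 747`), a one-class-per-genus fundamental `−D < −2 383 747` has `h(−D) = 2^{ω(D)−1} > 100`, i.e.
  `ω(D) ≥ 8`: beyond Watkins' range Euler's problem concerns only `D` with at least eight prime factors.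

HONESTY: no exceptional-zero theorem is proved; Euler's problem (`NoOneClassPerGenusBeyond 7392`, deck 11″) and every
explicit rung above GGZ remain OPEN; typed ≠ proved.
-/

namespace Summit.Parity.GeneralizedHardyLittlewood.Theorems.PrimeLevelFamEdgeIdeaDeltas.WucGenusFloor


open Literature.NumberTheory.QuadraticFields (watkins2004_table4)

open Summit.Parity.GeneralizedHardyLittlewood.Theorems.PrimeLevelFamEdgeIdeaDeltas.Wuc
open Literature.NumberTheory.LFunctions
open Literature.NumberTheory.LFunctions.Zhang2022.Skeleton
open Literature.NumberTheory.QuadraticFields.Quadratic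
open Literature.NumberTheory.QuadraticFields.BinaryQuadraticForm (assignedCharCount binQF_classNumber_eq
  card_filter_ambiguous_reducedForms assignedCharCount_eq_card_primeFactors_of_isFundamental)

/-! ### C.1 Bookkeeping at an odd primitive quadratic character -/

/-- An odd character is not trivial. [folklore] -/
theorem ne_one_of_odd {D : ℕ} {χ : DirichletCharacter ℂ D} (hodd : χ.Odd) : χ ≠ 1 := by
  intro h1
  have hm : χ (-1) = -1 := hodd
  rw [h1, MulChar.one_apply isUnit_one.neg] at hm
  norm_num at hm

/-- `−D ≡ 0, 1 (mod 4)` when `D` carries an odd primitive quadratic character (`−D` is fundamental).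
[cite: MontgomeryVaughan2007, Theorem 9.13] -/
theorem neg_mod_four_of_odd_primitive {D : ℕ} [NeZero D] {χ : DirichletCharacter ℂ D}
    (hprim : χ.IsPrimitive) (hquad : χ.IsQuadratic) (hodd : χ.Odd) :
    (-(D : ℤ)) % 4 = 0 ∨ (-(D : ℤ)) % 4 = 1 := by
  rcases PrimitiveQuadratic.isFundamentalDiscriminant_neg hprim hquad hodd with ⟨h1, -, -⟩ | ⟨h4, -, -⟩
  · exact Or.inr h1
  · exact Or.inl (Int.emod_eq_zero_of_dvd h4)

/-- `μ(−D) = ω(D)` for fundamental `−D`. [cite: Cox2013, §6.A Exercise 6.1] -/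
theorem assignedCharCount_neg_eq_card_primeFactors {D : ℕ} [NeZero D] {χ : DirichletCharacter ℂ D}
    (hprim : χ.IsPrimitive) (hquad : χ.IsQuadratic) (hodd : χ.Odd) :
    assignedCharCount (-(D : ℤ)) = D.primeFactors.card := by
  have hD0 : (0 : ℤ) < D := by exact_mod_cast Nat.pos_of_ne_zero (NeZero.ne D)
  have h := assignedCharCount_eq_card_primeFactors_of_isFundamental (D := -(D : ℤ)) (by linarith)
    (PrimitiveQuadratic.isFundamentalDiscriminant_neg hprim hquad hodd)
  rw [h]
  simp

/-- **Dirichlet's class number formula in form currency: `h(−D) = √D·‖L(1,χ)‖/π`** for an odd primitive quadratic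
`χ` mod `D > 4`. [cite: MontgomeryVaughan2007, §10.1] [cite: Cox2013, §7.B Thm. 7.7 (ii)] -/
theorem binQF_classNumber_neg_eq {D : ℕ} [NeZero D] (hD : 4 < D) {χ : DirichletCharacter ℂ D}
    (hprim : χ.IsPrimitive) (hquad : χ.IsQuadratic) (hodd : χ.Odd) :
    (BinQF.classNumber (-(D : ℤ)) : ℝ) = Real.sqrt D * ‖χ.LFunction 1‖ / Real.pi := by
  obtain ⟨K, _, _, h2, hdK⟩ := exists_quadraticField_of_odd_primitive hprim hquad hodd
  have hD0 : (0 : ℤ) < D := by exact_mod_cast Nat.pos_of_ne_zero (NeZero.ne D)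
  have hneg : -(D : ℤ) < 0 := by linarith
  have hd : NumberField.discr K < 0 := by rw [hdK]; exact hneg
  have hre := GoldfeldSchinzel1975.LFunction_one_re_eq hprim hquad hodd hD K h2 hdK
  have hnorm := Siegel.LFunction_one_re_eq_norm χ (ne_one_of_odd hodd) hquad.sq_eq_one
  have hcard := card_reducedForms_eq_classNumber (K := K) h2 hd
  rw [hdK] at hcard
  rw [binQF_classNumber_eq _ hneg, hcard, ← hnorm, hre]
  have hsqrt : 0 < Real.sqrt D := Real.sqrt_pos.2 (by exact_mod_cast Nat.pos_of_ne_zero (NeZero.ne D))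
  field_simp

/-! ### C.2 The genus floor and the equality case -/

/-- `2^{μ−1} ≤ h(D)` (the ambiguous reduced forms number `2^{μ−1}`). [cite: Cox2013, §3.A Prop. 3.11] -/
theorem two_pow_le_binQF_classNumber {D : ℤ} (hD : D < 0) (h4 : D % 4 = 0 ∨ D % 4 = 1) :
    2 ^ (assignedCharCount D - 1) ≤ BinQF.classNumber D := by
  rw [binQF_classNumber_eq D hD, Literature.NumberTheory.QuadraticFields.BinaryQuadraticForm.classNumber,
    ← card_filter_ambiguous_reducedForms hD h4]
  exact Finset.card_filter_le _ _

/-- **GENUS FLOOR (PROVED explicit-rail rung): `π·2^{ω(D)−1}/√D ≤ ‖L(1,χ)‖`** for every odd primitive quadratic `χ`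
mod `D > 4`. [cite: Cox2013, §3.A Prop. 3.11] [cite: MontgomeryVaughan2007, §10.1] -/
theorem genusFloor_le_norm_LFunction_one {D : ℕ} [NeZero D] (hD : 4 < D) {χ : DirichletCharacter ℂ D}
    (hprim : χ.IsPrimitive) (hquad : χ.IsQuadratic) (hodd : χ.Odd) :
    Real.pi * 2 ^ (D.primeFactors.card - 1) / Real.sqrt D ≤ ‖χ.LFunction 1‖ := by
  have hD0 : (0 : ℤ) < D := by exact_mod_cast Nat.pos_of_ne_zero (NeZero.ne D)
  have hle := two_pow_le_binQF_classNumber (D := -(D : ℤ)) (by linarith)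
    (neg_mod_four_of_odd_primitive hprim hquad hodd)
  rw [assignedCharCount_neg_eq_card_primeFactors hprim hquad hodd] at hle
  have hleR : (2 : ℝ) ^ (D.primeFactors.card - 1) ≤ (BinQF.classNumber (-(D : ℤ)) : ℝ) := by
    exact_mod_cast hle
  rw [binQF_classNumber_neg_eq hD hprim hquad hodd] at hleR
  have hsqrt : 0 < Real.sqrt D := Real.sqrt_pos.2 (by exact_mod_cast Nat.pos_of_ne_zero (NeZero.ne D))
  rw [le_div_iff₀ Real.pi_pos] at hleR
  rw [div_le_iff₀ hsqrt]
  calc Real.pi * 2 ^ (D.primeFactors.card - 1) = 2 ^ (D.primeFactors.card - 1) * Real.pi := mul_comm _ _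
    _ ≤ Real.sqrt D * ‖χ.LFunction 1‖ := hleR
    _ = ‖χ.LFunction 1‖ * Real.sqrt D := mul_comm _ _

/-- **One class per genus at `−D` ⟺ EQUALITY in the genus floor: `‖L(1,χ)‖ = π·2^{ω(D)−1}/√D`.**
[cite: Cox2013, §3.C Thm. 3.22 ((ii) ⟺ (v))] [cite: MontgomeryVaughan2007, §10.1] -/
theorem oneClassPerGenus_iff_norm_eq_genusFloor {D : ℕ} [NeZero D] (hD : 4 < D)
    {χ : DirichletCharacter ℂ D} (hprim : χ.IsPrimitive) (hquad : χ.IsQuadratic) (hodd : χ.Odd) :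
    OneClassPerGenus (-(D : ℤ)) ↔
      ‖χ.LFunction 1‖ = Real.pi * 2 ^ (D.primeFactors.card - 1) / Real.sqrt D := by
  have hD0 : (0 : ℤ) < D := by exact_mod_cast Nat.pos_of_ne_zero (NeZero.ne D)
  rw [oneClassPerGenus_iff_classNumber_eq (by linarith) (neg_mod_four_of_odd_primitive hprim hquad hodd),
    assignedCharCount_neg_eq_card_primeFactors hprim hquad hodd]
  have hcast : BinQF.classNumber (-(D : ℤ)) = 2 ^ (D.primeFactors.card - 1) ↔
      (BinQF.classNumber (-(D : ℤ)) : ℝ) = (2 : ℝ) ^ (D.primeFactors.card - 1) := by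
    constructor
    · intro h; exact_mod_cast h
    · intro h; exact_mod_cast h
  rw [hcast, binQF_classNumber_neg_eq hD hprim hquad hodd]
  have hsqrt : 0 < Real.sqrt D := Real.sqrt_pos.2 (by exact_mod_cast Nat.pos_of_ne_zero (NeZero.ne D))
  constructor
  · intro h
    rw [div_eq_iff Real.pi_pos.ne'] at h
    rw [eq_div_iff hsqrt.ne']
    calc ‖χ.LFunction 1‖ * Real.sqrt D = Real.sqrt D * ‖χ.LFunction 1‖ := mul_comm _ _
      _ = 2 ^ (D.primeFactors.card - 1) * Real.pi := h
      _ = Real.pi * 2 ^ (D.primeFactors.card - 1) := mul_comm _ _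
  · intro h
    rw [h]
    field_simp

/-- Hence the genus floor is STRICT exactly off the one-class-per-genus discriminants. [cite: Cox2013, §3.C Thm. 3.22] -/
theorem genusFloor_lt_iff_not_oneClassPerGenus {D : ℕ} [NeZero D] (hD : 4 < D)
    {χ : DirichletCharacter ℂ D} (hprim : χ.IsPrimitive) (hquad : χ.IsQuadratic) (hodd : χ.Odd) :
    Real.pi * 2 ^ (D.primeFactors.card - 1) / Real.sqrt D < ‖χ.LFunction 1‖ ↔
      ¬ OneClassPerGenus (-(D : ℤ)) := by
  rw [oneClassPerGenus_iff_norm_eq_genusFloor hD hprim hquad hodd]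
  constructor
  · intro h heq; exact h.ne' heq
  · intro h; exact lt_of_le_of_ne (genusFloor_le_norm_LFunction_one hD hprim hquad hodd) (fun e => h e.symm)

/-! ### C.3 Euler's problem on fundamental discriminants = the strict genus floor -/

/-- **Euler's idoneal problem restricted to fundamental discriminants** (per odd primitive quadratic `χ` mod
`D > N`: no such `−D` has one class per genus). OPEN for every `N` (Weinberger 1973: at most one fundamental `−D`
beyond Euler's table; EKN 2020: none with `D ≤ 3.1·10^20`). [cite: Cox2013, §3.C remarks after Prop. 3.24] [cite: Weinberger1973Exponents, Theorem 1] -/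
def NoOneClassPerGenusBeyondFund (N : ℕ) : Prop :=
  ∀ (D : ℕ) [NeZero D] (χ : DirichletCharacter ℂ D),
    N < D → χ.IsPrimitive → χ.IsQuadratic → χ.Odd → ¬ OneClassPerGenus (-(D : ℤ))

/-- **The strict genus floor beyond `N`** (explicit-rail rung in the leaf's currency):
`π·2^{ω(D)−1}/√D < ‖L(1,χ)‖` for every odd primitive quadratic `χ` mod `D > N`. [cite: Cox2013, §3.A Prop. 3.11] -/
def GenusFloorStrictBeyond (N : ℕ) : Prop :=
  ∀ (D : ℕ) [NeZero D] (χ : DirichletCharacter ℂ D),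
    N < D → χ.IsPrimitive → χ.IsQuadratic → χ.Odd →
      Real.pi * 2 ^ (D.primeFactors.card - 1) / Real.sqrt D < ‖χ.LFunction 1‖

/-- Part B's rung (all discriminants) gives the fundamental one. [folklore] -/
theorem noOneClassPerGenusBeyondFund_of_beyond {N : ℕ} (h : NoOneClassPerGenusBeyond N) :
    NoOneClassPerGenusBeyondFund N := fun D _ χ hND hp hq ho =>
  h (-(D : ℤ)) (by omega) (neg_mod_four_of_odd_primitive hp hq ho)

/-- **Euler's problem on fundamentals ⟺ the strict genus floor** (`N ≥ 4`). [cite: Cox2013, §3.C Thm. 3.22] [cite: MontgomeryVaughan2007, §10.1] -/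
theorem noOneClassPerGenusBeyondFund_iff_genusFloorStrict {N : ℕ} (hN : 4 ≤ N) :
    NoOneClassPerGenusBeyondFund N ↔ GenusFloorStrictBeyond N := by
  constructor
  · intro h D _ χ hND hp hq ho
    exact (genusFloor_lt_iff_not_oneClassPerGenus (lt_of_le_of_lt hN hND) hp hq ho).2 (h D χ hND hp hq ho)
  · intro h D _ χ hND hp hq ho
    exact (genusFloor_lt_iff_not_oneClassPerGenus (lt_of_le_of_lt hN hND) hp hq ho).1 (h D χ hND hp hq ho)

/-- The rail is monotone in the threshold. [folklore] -/
theorem genusFloorStrictBeyond_mono {N N' : ℕ} (hNN : N ≤ N') (h : GenusFloorStrictBeyond N) :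
    GenusFloorStrictBeyond N' := fun D _ χ hND hp hq ho => h D χ (lt_of_le_of_lt hNN hND) hp hq ho

/-! ### C.4 BC2-converse of K-L13-5: what each leaf buys on the genus rail -/

/-- **EXPLICIT leaf ⇒ strict genus floor beyond the crossover.** The hypothesis `hcross` is the definition of the
card's `N×(c₁,A)`: the least `N` with `π·2^{ω(D)−1}/√D < c₁/(log D)^A` for all `D > N` (true for `N` large as
`2^{ω(D)} = D^{O(1/log log D)}`; for `(c₁,A) = (1,4)` it is `≈ 10^26–10^27`, driven by near-primorial `D`).
[cite: Zhang2022LandauSiegel, §1 Theorem 1 (explicit shape)] [cite: Cox2013, §3.A Prop. 3.11] -/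
theorem genusFloorStrictBeyond_of_explicit {c₁ : ℝ} {A : ℕ} {N : ℕ} (hN : 3 ≤ N)
    (hleaf : LOneLowerBoundExplicit c₁ A)
    (hcross : ∀ D : ℕ, N < D →
      Real.pi * 2 ^ (D.primeFactors.card - 1) / Real.sqrt D < c₁ / Real.log D ^ A) :
    GenusFloorStrictBeyond N := fun D _ χ hND hp hq ho =>
  lt_of_lt_of_le (hcross D hND) (hleaf D χ (by omega) hq hp)

/-- **EXPLICIT leaf ⇒ Euler's problem on fundamentals beyond `N×(c₁,A)`** (`N ≥ 4`). [cite: Zhang2022LandauSiegel, §1 Theorem 1 (explicit shape)] [cite: Cox2013, §3.C Thm. 3.22] -/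
theorem noOneClassPerGenusBeyondFund_of_explicit {c₁ : ℝ} {A : ℕ} {N : ℕ} (hN : 4 ≤ N)
    (hleaf : LOneLowerBoundExplicit c₁ A)
    (hcross : ∀ D : ℕ, N < D →
      Real.pi * 2 ^ (D.primeFactors.card - 1) / Real.sqrt D < c₁ / Real.log D ^ A) :
    NoOneClassPerGenusBeyondFund N :=
  (noOneClassPerGenusBeyondFund_iff_genusFloorStrict hN).2
    (genusFloorStrictBeyond_of_explicit (by omega) hleaf hcross)

/-- **∃-leaf ⇒ only `∃ N`** (Chowla's theorem shape, known unconditionally — the ∃-leaf earns nothing on this rail);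
the growth fact `π·2^{ω(D)−1}(log D)^A/√D → 0` is supplied as the hypothesis `hgrowth`.
[cite: Zhang2022LandauSiegel, §1 Theorem 1] [cite: Cox2013, §3.C remarks after Prop. 3.24 (Chowla 1934)] -/
theorem exists_noOneClassPerGenusBeyondFund_of_lOneLowerBound {A : ℕ} (hleaf : LOneLowerBound A)
    (hgrowth : ∀ c : ℝ, 0 < c → ∃ N : ℕ, 4 ≤ N ∧ ∀ D : ℕ, N < D →
      Real.pi * 2 ^ (D.primeFactors.card - 1) / Real.sqrt D < c / Real.log D ^ A) :
    ∃ N : ℕ, 4 ≤ N ∧ NoOneClassPerGenusBeyondFund N := by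
  obtain ⟨c₁, hc₁, h⟩ := hleaf
  obtain ⟨N, hN4, hN⟩ := hgrowth c₁ hc₁
  refine ⟨N, hN4, (noOneClassPerGenusBeyondFund_iff_genusFloorStrict hN4).2 ?_⟩
  intro D _ χ hND hp hq ho
  exact lt_trans (hN D hND) (h D χ (by omega) hq hp)

/-- Rail placement, kernel-visible: Part B's Euler rung `NoOneClassPerGenusBeyond 7392` gives the strict genus floor
beyond `7392` at odd primitive quadratic characters. [cite: Cox2013, §3.C Thm. 3.22] -/
theorem genusFloorStrictBeyond_7392_of_euler (h : NoOneClassPerGenusBeyond 7392) :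
    GenusFloorStrictBeyond 7392 :=
  (noOneClassPerGenusBeyondFund_iff_genusFloorStrict (by norm_num)).1 (noOneClassPerGenusBeyondFund_of_beyond h)

/-! ### C.5 (= Part D) The Watkins residue: modulo `watkins2004_table4`, a further one-class-per-genus fundamental `D` has `ω(D) ≥ 8` -/

/-- **(Watkins' Table 4) ⇒ a one-class-per-genus fundamental discriminant `−D < −2 383 747` has at least `8` prime
factors** (`h(−D) = 2^{ω(D)−1} > 100`). [cite: Watkins2004ClassNumbers, Table 4 p. 936] [cite: Cox2013, §3.C Thm. 3.22] -/
theorem eight_le_card_primeFactors_of_oneClassPerGenus (hW : watkins2004_table4) {D : ℕ} [NeZero D]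
    (hD : 2383747 < D) {χ : DirichletCharacter ℂ D} (hprim : χ.IsPrimitive) (hquad : χ.IsQuadratic)
    (hodd : χ.Odd) (h1 : OneClassPerGenus (-(D : ℤ))) : 8 ≤ D.primeFactors.card := by
  obtain ⟨K, _, _, h2, hdK⟩ := exists_quadraticField_of_odd_primitive hprim hquad hodd
  have hD0 : (0 : ℤ) < D := by exact_mod_cast Nat.pos_of_ne_zero (NeZero.ne D)
  have hneg : -(D : ℤ) < 0 := by linarith
  have hd : NumberField.discr K < 0 := by rw [hdK]; exact hneg
  have hnat : (NumberField.discr K).natAbs = D := by rw [hdK]; simp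
  have h100 := Literature.NumberTheory.QuadraticFields.Watkins2004.hundred_lt_classNumber hW K h2 hd
    (by rw [hnat]; exact hD)
  have hcard := card_reducedForms_eq_classNumber (K := K) h2 hd
  rw [hdK] at hcard
  have hh := (oneClassPerGenus_iff_classNumber_eq hneg (neg_mod_four_of_odd_primitive hprim hquad hodd)).1 h1
  rw [assignedCharCount_neg_eq_card_primeFactors hprim hquad hodd, binQF_classNumber_eq _ hneg, hcard] at hh
  rw [hh] at h100
  by_contra hlt
  have h7 : D.primeFactors.card - 1 ≤ 6 := by omega
  have := Nat.pow_le_pow_right (show 0 < 2 by norm_num) h7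
  omega

/-- Hence, modulo Watkins' table, Euler's problem on fundamental discriminants beyond `2 383 747` is a statement
about `D` with `ω(D) ≥ 8` only. [cite: Watkins2004ClassNumbers, Table 4 p. 936] -/
theorem not_oneClassPerGenus_of_card_primeFactors_le_seven (hW : watkins2004_table4) {D : ℕ} [NeZero D]
    (hD : 2383747 < D) {χ : DirichletCharacter ℂ D} (hprim : χ.IsPrimitive) (hquad : χ.IsQuadratic)
    (hodd : χ.Odd) (hω : D.primeFactors.card ≤ 7) : ¬ OneClassPerGenus (-(D : ℤ)) := fun h1 =>
  absurd (eight_le_card_primeFactors_of_oneClassPerGenus hW hD hprim hquad hodd h1) (by omega)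

end Summit.Parity.GeneralizedHardyLittlewood.Theorems.PrimeLevelFamEdgeIdeaDeltas.WucGenusFloor
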